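import Summits.Ventures.QEC.Census.CertCoverLevel
import Summits.Ventures.QEC.Census.CertCoverTransport
import HarnessLib

/-!
# Cover reduction, part 5: orbit representatives — transporting a solved problem along a cover-compatible automorphism
# (qec lane ε, director-qec R29; census/search-9/cover/README.md §3 «orbit reps», type-10 review G3)

On top of qec-type-12's `Census/CertCoverTransport.lean` (`Cover2.permCompatOK`, ★ `Cover2.push_permWord`:
`P (perm · v) = permq · (P v)`, `popc_permWord_permFun`) and `Census/BZAutPerm.lean` (`rowMapOK`,
`exists_submatrix_eq_of_rowMapOK`) with `CSSCode.zLogical_comp_equiv_symm_of_rowMap`: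
* `bad_permWord` — a tabulated permutation mapping `H^X` rows to `H^X` rows and `H^Z` rows to `H^Z` rows carries every
  word with zero `H^X`-syndrome outside `rowspace H^Z` to another such word (word level);
* ★ `liftOK_transport` — if NO such word of weight `≤ W` upstairs projects onto `u_rep`, and `(perm, permq)` is a
  cover-compatible automorphism pair with `permq · u = u_rep`, then no such word of weight `≤ W` projects onto `u`.
So a cover certificate solves the coset problem of ONE representative per orbit and lists, for every other low-weight
word downstairs, the table index of an automorphism carrying it to its representative.
HONEST FRAMING: generic; everything proved; no definitions, no instances, no notation.
-/

namespace Summit.Ventures.QEC.Census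

open Matrix Literature.InformationTheory.QuantumCodes

/-- A transported word is below `2^n` (valid table). -/
theorem permWord_permFun_lt_two_pow {n : ℕ} {perm : List ℕ} (h : permListOK n perm = true) (w : ℕ) :
    permWord (permFun perm) w n < 2 ^ n :=
  Nat.lt_pow_two_of_testBit _ fun _ hj => testBit_permWord_of_le h w hj

/-- **Automorphisms transport non-trivial logicals** (word level): if `perm` is a valid table mapping `H^X` rows to
`H^X` rows and `H^Z` rows to `H^Z` rows, then for every word `v` with `H^X v = 0` and `v ∉ rowspace H^Z` the transported
word has the same two properties. -/
theorem bad_permWord {n : ℕ} {HX HZ perm rowsX rowsZ : List ℕ} (hcomm : rowMatrix n HX * (rowMatrix n HZ)ᵀ = 0)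
    (hperm : permListOK n perm = true) (hX : rowMapOK n HX perm rowsX = true) (hZ : rowMapOK n HZ perm rowsZ = true)
    {v : ℕ} (hsyn : synZero n HX v = true) (hnot : ofBits n v ∉ rowSpace (rowMatrix n HZ)) :
    synZero n HX (permWord (permFun perm) v n) = true ∧
      ofBits n (permWord (permFun perm) v n) ∉ rowSpace (rowMatrix n HZ) := by
  obtain ⟨ρX, hρX⟩ := exists_submatrix_eq_of_rowMapOK hperm hX
  obtain ⟨ρZ, hρZ⟩ := exists_submatrix_eq_of_rowMapOK hperm hZ
  have h := (CSSCode.ofMatrices (rowMatrix n HX) (rowMatrix n HZ) hcomm).zLogical_comp_equiv_symm_of_rowMap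
    (ρX := ρX) (ρZ := ρZ) hρX hρZ (v := ofBits n v) ⟨(synZero_iff _ _ _).1 hsyn, hnot⟩
  rw [← ofBits_permWord_permFun hperm] at h
  exact ⟨(synZero_iff _ _ _).2 h.1, h.2⟩

/-- **Transport of a solved problem to its orbit** (LEVEL 1→0 with orbit representatives): suppose NO word of weight
`≤ W` upstairs with zero `H^X`-syndrome outside `rowspace H^Z` projects onto `u_rep`, and `(perm, permq)` is a
cover-compatible automorphism pair (`permCompatOK`, both row maps) with `permq · u = u_rep`; then no such word of
weight `≤ W` projects onto `u` either. -/
theorem liftOK_transport {c : Cover2} (hc : c.ok = true) {HX HZ perm permq rowsX rowsZ : List ℕ}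
    (hcomm : rowMatrix c.n HX * (rowMatrix c.n HZ)ᵀ = 0) (hcompat : c.permCompatOK perm permq = true)
    (hX : rowMapOK c.n HX perm rowsX = true) (hZ : rowMapOK c.n HZ perm rowsZ = true) {urep u W : ℕ}
    (hrep : ∀ v : ℕ, v < 2 ^ c.n → synZero c.n HX v = true → ofBits c.n v ∉ rowSpace (rowMatrix c.n HZ) →
      popc c.n v ≤ W → c.push v ≠ urep)
    (hu : permWord (permFun permq) u c.nq = urep) :
    ∀ v : ℕ, v < 2 ^ c.n → synZero c.n HX v = true → ofBits c.n v ∉ rowSpace (rowMatrix c.n HZ) →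
      popc c.n v ≤ W → c.push v ≠ u := by
  have hperm : permListOK c.n perm = true := by
    simp only [Cover2.permCompatOK, Bool.and_eq_true] at hcompat; exact hcompat.1.1
  intro v hv hsyn hnot hwt hpu
  obtain ⟨hsyn', hnot'⟩ := bad_permWord hcomm hperm hX hZ hsyn hnot
  refine hrep _ (permWord_permFun_lt_two_pow hperm v) hsyn' hnot' ?_ ?_
  · rw [popc_permWord_permFun hperm v]; exact hwt
  · rw [Cover2.push_permWord hc hcompat, hpu, hu]

end Summit.Ventures.QEC.Census
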